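import Summits.Ventures.CertifiedManyBodySolver.Downfold.OneBandBox
import Literature.MathematicalPhysics.QuantumLattice.TorusSectorGibbsScaleBoxWords
import HarnessLib

/-!
# The temperature axis of a one-band box: `T > 0` words from `t ≡ 1` thermal cell words
# (consumption direction of the S1/S2 seam for thermal certificates)

Venture CertifiedManyBodySolver, cell `pub/hubbard-downfold` (stage S1), seat hubbard-downfold-unc-2;
namespace `Summit.Ventures.CertifiedManyBodySolver.Downfold`; companion of `OneBandBox`
(`holdsOn_oneBand_of_cell`: a `t ≡ 1` word on the `(tp/t, U/t, n)` cell ⇒ a word on the box;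
`holdsOn_energyDensityTT'_phys`: energies through the scale entry `t_eV`). A phase-map cell of the
material oracle sits at a physical inverse temperature `β` (or a range `[β₁, β₂]`; `β = 1/(k_B T_K)` in
`eV⁻¹` when `t_eV` is in eV), whereas every `T > 0` certificate is produced for the UNIT model
`H(1, s, u)` at a unit inverse temperature `β̃`, in the torus-limit thermal convention of record
(canonical sector Gibbs torus limits, `IsTorusLimitOfMixture (sectorGibbsCount n) (sectorGibbsWeightTT' β̃ 1 s u n) (sectorGibbsVectorTT' 1 s u n) Ls`).
By `Literature/…/TorusSectorGibbsScaleCovariance` the thermal torus limits of the physical model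
`H(t, ts, tu)` at `β` ARE those of `H(1, s, u)` at `β̃ = βt`; over a box with scale entry
`t_eV ∈ [t_lo, t_hi]` and a cell `β ∈ [β₁, β₂]` the unit inverse temperature sweeps `[β₁ t_lo, β₂ t_hi]`.

* `holdsOn_thermalWord_phys` — THE THERMAL SEAM: a property `P₁ s u n ω` of states certified for every
  `(s, u, n)` of the cell `eS.encl × eU.encl × eN.encl`, every `β̃ ∈ [β₁·eT.lo, β₂·eT.hi]` and every unit
  thermal torus limit (`Ls → ∞`), holds on the box — for every `p ∈ B`, every `β ∈ [β₁, β₂]` and every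
  thermal torus limit of `H(p t, p t · p s, p t · p u)` at `β` (`0 ≤ β₁`, `0 ≤ eT.lo`). Dimensionless
  words (correlators, pair / docc words) need nothing more.
* `holdsOn_thermalWord_phys_of_Ici` — low-temperature cells (`β ≥ β₁`, i.e. `T ≤ T₁` down to `T = 0`):
  a unit word valid for all `β̃ ≥ θ` holds on the box at every `β ≥ β₁` once `θ ≤ β₁ · eT.lo`.
* `holdsOn_thermalMeanEnergy_phys` — thermal ENERGIES through the scale: a unit thermal energy enclosure
  `E ∋ e_{Φ(1,s,u)}(ω̃)` on cell × `β̃`-range gives `e_{Φ(t,ts,tu)}(ω) ∈ eT.encl · E` (Moore product, unit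
  of `t_eV`) for every physical thermal torus limit on the box.

Everything is PROVED (three short compositions of the Literature lemmas
`thermalWord_on_scaleBox_of_unit_Icc` / `…_Ici` with the box membership); no definition, no named fact.
HONEST FRAMING: exact covariance; nothing here bounds the temperature dependence of a word; a box is a
systematic modelling claim (hypothesis `B.Mem p`), the transported word is certified for the model family.
-/

namespace Summit.Ventures.CertifiedManyBodySolver.Downfold

open NonemptyInterval Filter Literature.MathematicalPhysics.QuantumLattice
open Literature.MathematicalPhysics.QuantumLattice.ThermodynamicLimit
open Literature.MathematicalPhysics.QuantumLattice.InfVolFermionState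

/-- **The thermal S1/S2 seam (dimensionless words).** Let the one-band box `B` carry entries
`eT, eS, eU, eN` for `t_eV`, `tp/t`, `U/t`, `n` with `0 ≤ eT.encl.fst`, and let the temperature cell be
`β ∈ [β₁, β₂]` with `0 ≤ β₁`. If a property `P₁ s u n ω` holds for every `(s, u, n)` of the cell, every unit
inverse temperature `β̃` with `β₁·eT.lo ≤ β̃ ≤ β₂·eT.hi`, and every torus limit `ω` (`Ls → ∞`) of the
canonical sector Gibbs states of the UNIT model `H(1, s, u)` at `β̃`, then for every `p ∈ B`, every
`β ∈ [β₁, β₂]` and every torus limit `ω` of the canonical sector Gibbs states of the PHYSICAL model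
`H(p t, p t·p s, p t·p u)` at `β` (density `p n`), `P₁ (p s) (p u) (p n) ω` holds. [folklore] -/
theorem holdsOn_thermalWord_phys {B : OneBandBox} {eT eS eU eN : Entry}
    (hT : B .tEV = some eT) (hS : B .tpOverT = some eS) (hU : B .UOverT = some eU)
    (hN : B .filling = some eN) (hT0 : 0 ≤ eT.encl.fst) {β₁ β₂ : ℝ} (hβ₁ : 0 ≤ β₁)
    {P₁ : ℝ → ℝ → ℝ → InfVolFermionState 2 → Prop}
    (hP : ∀ s u n : ℝ, s ∈ eS.encl.ratCast ℝ → u ∈ eU.encl.ratCast ℝ → n ∈ eN.encl.ratCast ℝ →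
      ∀ β' : ℝ, β₁ * (eT.encl.fst : ℝ) ≤ β' → β' ≤ β₂ * (eT.encl.snd : ℝ) →
      ∀ (Ls : ℕ → ℕ) (ω : InfVolFermionState 2), Tendsto Ls atTop atTop →
        ω.IsTorusLimitOfMixture (sectorGibbsCount n) (fun L => sectorGibbsWeightTT' β' 1 s u n L)
          (fun L => sectorGibbsVectorTT' 1 s u n L) Ls → P₁ s u n ω) :
    HoldsOn (fun p : OneBandCoord → ℝ =>
      ∀ β ∈ Set.Icc β₁ β₂, ∀ (Ls : ℕ → ℕ) (ω : InfVolFermionState 2), Tendsto Ls atTop atTop →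
        ω.IsTorusLimitOfMixture (sectorGibbsCount (p .filling))
          (fun L => sectorGibbsWeightTT' β (p .tEV) (p .tEV * p .tpOverT) (p .tEV * p .UOverT)
            (p .filling) L)
          (fun L => sectorGibbsVectorTT' (p .tEV) (p .tEV * p .tpOverT) (p .tEV * p .UOverT)
            (p .filling) L) Ls →
        P₁ (p .tpOverT) (p .UOverT) (p .filling) ω) B := by
  intro p hp β hβ Ls ω hLs hω
  have ht := mem_ratCast_iff.1 (hp _ _ hT)
  have ht0 : (0 : ℝ) ≤ p .tEV := le_trans (by exact_mod_cast hT0) ht.1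
  have hβ0 : 0 ≤ β := hβ₁.trans hβ.1
  have h₁ : β₁ * (eT.encl.fst : ℝ) ≤ β * (eT.encl.fst : ℝ) :=
    mul_le_mul_of_nonneg_right hβ.1 (by exact_mod_cast hT0)
  have h₂ : β * (eT.encl.snd : ℝ) ≤ β₂ * (eT.encl.snd : ℝ) :=
    mul_le_mul_of_nonneg_right hβ.2 (ht0.trans ht.2)
  exact thermalWord_on_scaleBox_of_unit_Icc (P₁ (p .tpOverT) (p .UOverT) (p .filling)) hβ0 h₁ h₂
    (fun β' hβ' ω' hω' => hP _ _ _ (hp _ _ hS) (hp _ _ hU) (hp _ _ hN) β' hβ'.1 hβ'.2 Ls ω' hLs hω')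
    (t₁ := (eT.encl.fst : ℝ)) (t₂ := (eT.encl.snd : ℝ)) ⟨ht.1, ht.2⟩ hω

/-- **Low-temperature cells** (`β ≥ β₁`, i.e. every temperature below `T₁`, down to `T = 0`): a unit
word valid for all `β̃ ≥ θ` holds, for every `p ∈ B` and every `β ≥ β₁`, for every thermal torus limit of
the physical model at `β`, as soon as `θ ≤ β₁ · eT.lo` (`0 ≤ β₁`, `0 ≤ eT.lo`): the threshold binds at the
SMALL end of the scale entry. [folklore] -/
theorem holdsOn_thermalWord_phys_of_Ici {B : OneBandBox} {eT eS eU eN : Entry}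
    (hT : B .tEV = some eT) (hS : B .tpOverT = some eS) (hU : B .UOverT = some eU)
    (hN : B .filling = some eN) (hT0 : 0 ≤ eT.encl.fst) {β₁ θ : ℝ} (hβ₁ : 0 ≤ β₁)
    (hθ : θ ≤ β₁ * (eT.encl.fst : ℝ))
    {P₁ : ℝ → ℝ → ℝ → InfVolFermionState 2 → Prop}
    (hP : ∀ s u n : ℝ, s ∈ eS.encl.ratCast ℝ → u ∈ eU.encl.ratCast ℝ → n ∈ eN.encl.ratCast ℝ →
      ∀ β' : ℝ, θ ≤ β' →
      ∀ (Ls : ℕ → ℕ) (ω : InfVolFermionState 2), Tendsto Ls atTop atTop →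
        ω.IsTorusLimitOfMixture (sectorGibbsCount n) (fun L => sectorGibbsWeightTT' β' 1 s u n L)
          (fun L => sectorGibbsVectorTT' 1 s u n L) Ls → P₁ s u n ω) :
    HoldsOn (fun p : OneBandCoord → ℝ =>
      ∀ β : ℝ, β₁ ≤ β → ∀ (Ls : ℕ → ℕ) (ω : InfVolFermionState 2), Tendsto Ls atTop atTop →
        ω.IsTorusLimitOfMixture (sectorGibbsCount (p .filling))
          (fun L => sectorGibbsWeightTT' β (p .tEV) (p .tEV * p .tpOverT) (p .tEV * p .UOverT)
            (p .filling) L)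
          (fun L => sectorGibbsVectorTT' (p .tEV) (p .tEV * p .tpOverT) (p .tEV * p .UOverT)
            (p .filling) L) Ls →
        P₁ (p .tpOverT) (p .UOverT) (p .filling) ω) B := by
  intro p hp β hβ Ls ω hLs hω
  have ht := mem_ratCast_iff.1 (hp _ _ hT)
  have hβ0 : 0 ≤ β := hβ₁.trans hβ
  have h₁ : θ ≤ β * (eT.encl.fst : ℝ) :=
    hθ.trans (mul_le_mul_of_nonneg_right hβ (by exact_mod_cast hT0))
  exact thermalWord_on_scaleBox_of_unit_Ici (P₁ (p .tpOverT) (p .UOverT) (p .filling)) hβ0 h₁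
    (fun β' hβ' ω' hω' => hP _ _ _ (hp _ _ hS) (hp _ _ hU) (hp _ _ hN) β' hβ' Ls ω' hLs hω')
    ht.1 hω

/-- **Thermal energies on a one-band box (shape × scale).** With the entries and the temperature cell as
in `holdsOn_thermalWord_phys`, let `E` enclose the UNIT thermal energy density `e_{Φ(1,s,u)}(ω̃)` for
every `(s, u, n)` of the cell, every `β̃ ∈ [β₁·eT.lo, β₂·eT.hi]` and every unit thermal torus limit `ω̃`.
Then for every `p ∈ B`, every `β ∈ [β₁, β₂]` and every thermal torus limit `ω` of the physical model
`H(p t, p t·p s, p t·p u)` at `β`, the thermal energy density `e_{Φ(p t, p t·p s, p t·p u)}(ω)` lies in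
the Moore product `eT.encl · E` (unit = the unit of `t_eV`; `e_Φ` is homogeneous in the couplings,
`meanEnergy_hubbardTTPrime_smul`). [folklore] -/
theorem holdsOn_thermalMeanEnergy_phys {B : OneBandBox} {eT eS eU eN : Entry}
    {E : NonemptyInterval ℚ} (hT : B .tEV = some eT) (hS : B .tpOverT = some eS)
    (hU : B .UOverT = some eU) (hN : B .filling = some eN) (hT0 : 0 ≤ eT.encl.fst) {β₁ β₂ : ℝ}
    (hβ₁ : 0 ≤ β₁)
    (hE : ∀ s u n : ℝ, s ∈ eS.encl.ratCast ℝ → u ∈ eU.encl.ratCast ℝ → n ∈ eN.encl.ratCast ℝ →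
      ∀ β' : ℝ, β₁ * (eT.encl.fst : ℝ) ≤ β' → β' ≤ β₂ * (eT.encl.snd : ℝ) →
      ∀ (Ls : ℕ → ℕ) (ω : InfVolFermionState 2), Tendsto Ls atTop atTop →
        ω.IsTorusLimitOfMixture (sectorGibbsCount n) (fun L => sectorGibbsWeightTT' β' 1 s u n L)
          (fun L => sectorGibbsVectorTT' 1 s u n L) Ls →
        ω.meanEnergy (hubbardTTPrimeFermionInteraction 1 s u) 1 ∈ E.ratCast ℝ) :
    HoldsOn (fun p : OneBandCoord → ℝ =>
      ∀ β ∈ Set.Icc β₁ β₂, ∀ (Ls : ℕ → ℕ) (ω : InfVolFermionState 2), Tendsto Ls atTop atTop →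
        ω.IsTorusLimitOfMixture (sectorGibbsCount (p .filling))
          (fun L => sectorGibbsWeightTT' β (p .tEV) (p .tEV * p .tpOverT) (p .tEV * p .UOverT)
            (p .filling) L)
          (fun L => sectorGibbsVectorTT' (p .tEV) (p .tEV * p .tpOverT) (p .tEV * p .UOverT)
            (p .filling) L) Ls →
        ω.meanEnergy (hubbardTTPrimeFermionInteraction (p .tEV) (p .tEV * p .tpOverT)
          (p .tEV * p .UOverT)) 1 ∈ (eT.encl.mooreMul E).ratCast ℝ) B := by
  intro p hp β hβ Ls ω hLs hω
  have ht : p .tEV ∈ eT.encl.ratCast ℝ := hp _ _ hT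
  have hunit := holdsOn_thermalWord_phys hT hS hU hN hT0 hβ₁
    (P₁ := fun s u _ ω => ω.meanEnergy (hubbardTTPrimeFermionInteraction 1 s u) 1 ∈ E.ratCast ℝ)
    hE p hp β hβ Ls ω hLs hω
  have hsm := ω.meanEnergy_hubbardTTPrime_smul (p .tEV) 1 (p .tpOverT) (p .UOverT)
  rw [mul_one] at hsm
  rw [hsm, ratCast_mooreMul]
  exact mul_mem_mooreMul ht hunit

end Summit.Ventures.CertifiedManyBodySolver.Downfold
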